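import Literature.AlgebraicGeometry.HodgeTheory.HolomorphicBundleChernCharacterProofs
import Literature.AlgebraicGeometry.HodgeTheory.HodgeModelChernCharacter
import Literature.Geometry.Kaehler.ChernCharacterIndependenceProofs
import HarnessLib

/-!
# The Chern character class `ch_p(V) ∈ H²ᵖ(X(ℂ); ℂ)` of a cocycle on a Hodge model

Family `hodge`, layer `Literature/AlgebraicGeometry/HodgeTheory`. Companion of
`HolomorphicBundleChernCharacter` (Voisin I, Thm. 11.32 ⊗ ℂ, the named fact
`span_holomorphicBundleChernCharacter_eq_algebraicClasses`). There the `p`-th Chern character of a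
`C^∞` cocycle `V` on a Hodge model `A` of `X` had to be rendered as a SET
`HodgeModel.chernCharacterSet A V p ⊆ H²ᵖ(X(ℂ); ℂ)` ("in truth the singleton `{ch_p(V)}` […];
rendered as a set since the Chern–Weil theorems are not in the tree"). Both Chern–Weil theorems
are now PROVED in the tree (`Connection.exists_isChernCharacterForm`, Kobayashi II (2.4), in
`Geometry/Kaehler/ChernCharacterProofs`; `mk_eq_mk_of_isChernCharacterForm_holds`, Kobayashi II
(2.5)–(2.10), in `Geometry/Kaehler/ChernCharacterIndependenceProofs`), and so is the existence of
connections (`SmoothComplexVectorBundle.nonempty_connection`, `ConnectionExists`). Hence, PROVED here: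

* `HodgeModel.chernCharacterSet_subsingleton` / `exists_chernCharacterSet_eq_singleton`: the Chern
  character set of every cocycle is a singleton (non-empty by `chernCharacterSet_nonempty`; at most
  one element by Chern–Weil II and the injectivity of the pull-back `A.pullback`);
* `HodgeModel.chernCharacter A V p : complexBetti X (2 * p)` — **the `p`-th Chern character class
  `ch_p(V)` of the cocycle `V` in `H²ᵖ(X(ℂ); ℂ)`** (Kobayashi II Thm. 2.16 with (2.21): the class of
  `ch_p(E, D) = (1/p!) tr((−Ω/2πi)ᵖ)` for any connection `D`, transported to `X(ℂ)` by the de Rham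
  comparison of `A` and the pull-back), with `chernCharacterSet_eq_singleton`,
  `pullback_chernCharacter` (computed from ANY connection and ANY global Chern character form) and
  the links `pullback_chernCharacter_eq` / `pullback_chernCharacter_eq_chernCharacter` with the
  classes `V.chernCharacterDeRham p ∈ H²ᵖ_dR(M; ℂ)` and `V.chernCharacter A.deRham p ∈ H²ᵖ(M; ℂ)` of
  `Geometry/Kaehler/ChernCharacter`; `chernCharacter_trivial_succ` (`ch_{p+1}(M × ℂʳ) = 0`) and
  Whitney additivity `chernCharacter_directSum` (`ch_p(V ⊕ V') = ch_p(V) + ch_p(V')`, Kobayashi II (1.9));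
* `HodgeModel.holomorphicBundleChernCharacter_eq`: the generator set of the named fact is the set of
  the classes `ch_p(V)`, `V` a holomorphic cocycle — so Thm. 11.32 ⊗ ℂ now reads literally
  `span_ℂ {ch_p(V) | V holomorphic} = algebraicClasses X p`;
* `HodgeModel.mem_chernCharacterSet_iff_pullback_eq` / `mem_chernCharacterSet_iff_eq_chernCharacter`:
  the UNCONDITIONAL forms of the characterisation of `HodgeModelChernCharacter`
  (`mem_chernCharacterSet_iff_pullback_eq_chernCharacter`, stated there under the two Chern–Weil facts
  as hypotheses), both facts being discharged.

Normalisation: as explained in `HolomorphicBundleChernCharacter` (module docstring), `A.deRham` is a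
natural comparison family, so `ch_p(V)` is the integration-normalised class up to a non-zero scalar
depending only on the degree; spans are unaffected.

## References

* S. Kobayashi, *Differential Geometry of Complex Vector Bundles* (1987), Ch. II §2, Thm. 2.16,
  (2.4), (2.10), (2.20)–(2.21).
* C. Voisin, *Hodge Theory and Complex Algebraic Geometry I* (2002), §11.2 (Chern classes), Thm. 11.32.
-/

noncomputable section

open scoped Manifold ContDiff
open Literature.Geometry.Kaehler (SmoothComplexVectorBundle MForm IsSmoothForm IsClosedForm)
open Literature.NumberTheory.Transcendental (complexDeRhamCohomology mem_cclosedSmoothForms)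

namespace Literature.AlgebraicGeometry.HodgeTheory

open Literature.AlgebraicTopology.SingularHomology

variable {n : ℕ} {X : Motives.SchemeOver ℂ}

namespace HodgeModel

/-- **The Chern character set of a cocycle has at most one element** (Chern–Weil II: the de Rham
classes of all global Chern character forms of all connections on `V` coincide, Kobayashi II
(2.10), `mk_eq_mk_of_isChernCharacterForm_holds`; and the pull-back `A.pullback` is injective).
[cite: Kobayashi1987, Ch. II §2 (2.10) and Thm. 2.16] -/
theorem chernCharacterSet_subsingleton (A : HodgeModel n X) {ι : Type} {r : ℕ}
    (V : SmoothComplexVectorBundle ι A.model A.carrier r) (p : ℕ) :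
    (A.chernCharacterSet V p).Subsingleton := by
  rintro c ⟨D, θ, hs, hc, hθ, h⟩ c' ⟨D', θ', hs', hc', hθ', h'⟩
  apply A.pullback_injective (2 * p)
  rw [h, h', SmoothComplexVectorBundle.mk_eq_mk_of_isChernCharacterForm_holds A.model A.carrier V D D'
    p θ θ' hs hc hs' hc' hθ hθ']

/-- Hence **the Chern character set of every cocycle on a Hodge model is a singleton** (non-empty by
`chernCharacterSet_nonempty`: connections exist and Chern–Weil I). [cite: Kobayashi1987, Ch. II §2 Thm. 2.16] -/
theorem exists_chernCharacterSet_eq_singleton (A : HodgeModel n X) {ι : Type} {r : ℕ}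
    (V : SmoothComplexVectorBundle ι A.model A.carrier r) (p : ℕ) :
    ∃ c, A.chernCharacterSet V p = {c} :=
  Set.exists_eq_singleton_iff_nonempty_subsingleton.mpr
    ⟨A.chernCharacterSet_nonempty V p, A.chernCharacterSet_subsingleton V p⟩

/-- **The `p`-th Chern character class `ch_p(V) ∈ H²ᵖ(X(ℂ); ℂ)` of a `C^∞` cocycle `V` on a Hodge
model `A` of `X`**: the unique element of `chernCharacterSet A V p`, i.e. the class whose pull-back to
`M = A.carrier` is the comparison image `A.deRham[ch_p(V, D)]` of the de Rham class of a (any) global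
`p`-th Chern character form of a (any) connection `D` on `V` (Kobayashi II, Thm. 2.16 with (2.21):
"`ch_k(E)` is represented by the closed `2k`-form `ch_k(E, D)`"). [cite: Kobayashi1987, Ch. II §2 Thm. 2.16 and (2.20)–(2.21)] -/
def chernCharacter (A : HodgeModel n X) {ι : Type} {r : ℕ}
    (V : SmoothComplexVectorBundle ι A.model A.carrier r) (p : ℕ) : complexBetti X (2 * p) :=
  (A.chernCharacterSet_nonempty V p).some

/-- `ch_p(V)` belongs to the Chern character set. [cite: Kobayashi1987, Ch. II §2 Thm. 2.16] -/
theorem chernCharacter_mem (A : HodgeModel n X) {ι : Type} {r : ℕ}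
    (V : SmoothComplexVectorBundle ι A.model A.carrier r) (p : ℕ) :
    A.chernCharacter V p ∈ A.chernCharacterSet V p :=
  (A.chernCharacterSet_nonempty V p).some_mem

/-- **`chernCharacterSet A V p = {ch_p(V)}`.** [cite: Kobayashi1987, Ch. II §2 Thm. 2.16] -/
theorem chernCharacterSet_eq_singleton (A : HodgeModel n X) {ι : Type} {r : ℕ}
    (V : SmoothComplexVectorBundle ι A.model A.carrier r) (p : ℕ) :
    A.chernCharacterSet V p = {A.chernCharacter V p} :=
  (A.chernCharacterSet_subsingleton V p).eq_singleton_of_mem (A.chernCharacter_mem V p)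

/-- Every element of the Chern character set is `ch_p(V)`. [cite: Kobayashi1987, Ch. II §2 Thm. 2.16] -/
theorem chernCharacter_eq_of_mem (A : HodgeModel n X) {ι : Type} {r : ℕ}
    {V : SmoothComplexVectorBundle ι A.model A.carrier r} {p : ℕ} {c : complexBetti X (2 * p)}
    (hc : c ∈ A.chernCharacterSet V p) : A.chernCharacter V p = c :=
  A.chernCharacterSet_subsingleton V p (A.chernCharacter_mem V p) hc

/-- **`ch_p(V)` is computed by any connection**: for every connection `D` on `V` and every global
smooth closed `p`-th Chern character form `θ` of `D`, the pull-back of `ch_p(V)` to `M` is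
`A.deRham[θ]` (Kobayashi II (2.10): the class does not depend on `D`).
[cite: Kobayashi1987, Ch. II §2 (2.10) and Thm. 2.16] -/
theorem pullback_chernCharacter (A : HodgeModel n X) {ι : Type} {r : ℕ}
    (V : SmoothComplexVectorBundle ι A.model A.carrier r) (p : ℕ) (D : V.Connection)
    {θ : MForm 𝓘(ℝ, A.model) A.carrier ℂ (2 * p)} (hs : IsSmoothForm θ) (hc : IsClosedForm θ)
    (hθ : D.IsChernCharacterForm p θ) :
    A.pullback (2 * p) (A.chernCharacter V p) =
      A.deRham A.carrier (2 * p)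
        (complexDeRhamCohomology.mk A.model A.carrier (2 * p) ⟨θ, mem_cclosedSmoothForms hs hc⟩) := by
  obtain ⟨D', θ', hs', hc', hθ', h'⟩ := A.chernCharacter_mem V p
  rw [h', SmoothComplexVectorBundle.mk_eq_mk_of_isChernCharacterForm_holds A.model A.carrier V D' D
    p θ' θ hs' hc' hs hc hθ' hθ]

/-- **Compatibility with the de Rham Chern character of `Geometry/Kaehler/ChernCharacter`**: the
pull-back of `ch_p(V) ∈ H²ᵖ(X(ℂ); ℂ)` to `M` is the comparison image of the de Rham class
`V.chernCharacterDeRham p ∈ H²ᵖ_dR(M; ℂ)` (both are the class of `ch_p(V, D)` for any connection `D`,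
which exists). [cite: Kobayashi1987, Ch. II §2 Thm. 2.16 and (2.20)–(2.21)] -/
theorem pullback_chernCharacter_eq (A : HodgeModel n X) {ι : Type} {r : ℕ}
    (V : SmoothComplexVectorBundle ι A.model A.carrier r) (p : ℕ) :
    A.pullback (2 * p) (A.chernCharacter V p) = A.deRham A.carrier (2 * p) (V.chernCharacterDeRham p) := by
  obtain ⟨D⟩ := V.nonempty_connection
  obtain ⟨θ, hs, hc, hθ⟩ := D.exists_isChernCharacterForm p
  rw [A.pullback_chernCharacter V p D hs hc hθ, SmoothComplexVectorBundle.chernCharacterDeRham_eq_mk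
    (SmoothComplexVectorBundle.mk_eq_mk_of_isChernCharacterForm_holds A.model A.carrier) D hs hc hθ]

/-- The same link with the singular-cohomology Chern character `V.chernCharacter A.deRham p ∈ H²ᵖ(M; ℂ)`
of `Geometry/Kaehler/ChernCharacter`: `A.pullback (ch_p(V)) = ch_p(V)_M`. [cite: Kobayashi1987, Ch. II §2 Thm. 2.16] -/
theorem pullback_chernCharacter_eq_chernCharacter (A : HodgeModel n X) {ι : Type} {r : ℕ}
    (V : SmoothComplexVectorBundle ι A.model A.carrier r) (p : ℕ) :
    A.pullback (2 * p) (A.chernCharacter V p) = V.chernCharacter A.deRham p := by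
  rw [SmoothComplexVectorBundle.chernCharacter_def, pullback_chernCharacter_eq]

/-- **`ch_{p+1}` of the trivial bundle `M × ℂʳ` vanishes** (trivial connection, `θ = 0`).
[cite: Kobayashi1987, Ch. II §2 (2.21)] -/
theorem chernCharacter_trivial_succ (A : HodgeModel n X) (r p : ℕ) :
    A.chernCharacter (SmoothComplexVectorBundle.trivial A.model A.carrier r) (p + 1) = 0 :=
  A.chernCharacter_eq_of_mem (A.zero_mem_chernCharacterSet_trivial r p)

/-- **Whitney additivity in `H²ᵖ(X(ℂ); ℂ)`: `ch_p(V ⊕ V') = ch_p(V) + ch_p(V')`** (Kobayashi II (1.9);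
from `chernCharacterDeRham_directSum`, both Chern–Weil theorems being proved, connections existing,
and the pull-back being injective and linear). [cite: Kobayashi1987, Ch. II §1 (1.9)] -/
theorem chernCharacter_directSum (A : HodgeModel n X) {ι ι' : Type} {r s : ℕ}
    (V : SmoothComplexVectorBundle ι A.model A.carrier r) (V' : SmoothComplexVectorBundle ι' A.model A.carrier s)
    (p : ℕ) : A.chernCharacter (V.directSum V') p = A.chernCharacter V p + A.chernCharacter V' p := by
  apply A.pullback_injective (2 * p)
  rw [map_add, pullback_chernCharacter_eq, pullback_chernCharacter_eq, pullback_chernCharacter_eq,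
    SmoothComplexVectorBundle.chernCharacterDeRham_directSum
      (SmoothComplexVectorBundle.exists_isChernCharacterForm_holds A.model A.carrier)
      (SmoothComplexVectorBundle.mk_eq_mk_of_isChernCharacterForm_holds A.model A.carrier)
      V.nonempty_connection V'.nonempty_connection p, map_add]

/-- `ch_p(V)` of a holomorphic cocycle is one of "the Chern characters of the holomorphic vector
bundles on `X^an`". [cite: VoisinHodgeI2002, Thm. 11.32] -/
theorem chernCharacter_mem_holomorphicBundleChernCharacter (A : HodgeModel n X) {ι : Type} {r : ℕ}
    {V : SmoothComplexVectorBundle ι A.model A.carrier r} (hV : V.IsHolomorphic) (p : ℕ) :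
    A.chernCharacter V p ∈ A.holomorphicBundleChernCharacter p :=
  A.chernCharacterSet_subset_holomorphicBundleChernCharacter hV p (A.chernCharacter_mem V p)

/-- **The generator set of Thm. 11.32 ⊗ ℂ, made explicit**: the set
`holomorphicBundleChernCharacter A p` of `HolomorphicBundleChernCharacter` is exactly the set of the
classes `ch_p(V) ∈ H²ᵖ(X(ℂ); ℂ)` of the holomorphic cocycles `V` on the Hodge model (all index types,
all ranks). [cite: VoisinHodgeI2002, Thm. 11.31 and Thm. 11.32] -/
theorem holomorphicBundleChernCharacter_eq (A : HodgeModel n X) (p : ℕ) :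
    A.holomorphicBundleChernCharacter p =
      {c | ∃ (ι : Type) (r : ℕ) (V : SmoothComplexVectorBundle ι A.model A.carrier r),
        V.IsHolomorphic ∧ c = A.chernCharacter V p} := by
  ext c
  simp only [holomorphicBundleChernCharacter, Set.mem_setOf_eq, chernCharacterSet_eq_singleton,
    Set.mem_singleton_iff]

/-- **`chernCharacterSet = pullback⁻¹ {ch_p(V)}`, unconditionally**: the characterisation
`mem_chernCharacterSet_iff_pullback_eq_chernCharacter` of `HodgeModelChernCharacter`, fed the two
discharged Chern–Weil facts (`exists_isChernCharacterForm_holds`, Kobayashi II (2.4);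
`mk_eq_mk_of_isChernCharacterForm_holds`, Kobayashi II (2.10)).
[cite: Kobayashi1987, Ch. II §2 (2.4), (2.10) and Thm. 2.16] -/
theorem mem_chernCharacterSet_iff_pullback_eq (A : HodgeModel n X) {ι : Type} {r : ℕ}
    (V : SmoothComplexVectorBundle ι A.model A.carrier r) (p : ℕ) (c : complexBetti X (2 * p)) :
    c ∈ A.chernCharacterSet V p ↔ A.pullback (2 * p) c = V.chernCharacter A.deRham p :=
  A.mem_chernCharacterSet_iff_pullback_eq_chernCharacter
    (SmoothComplexVectorBundle.exists_isChernCharacterForm_holds A.model A.carrier)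
    (SmoothComplexVectorBundle.mk_eq_mk_of_isChernCharacterForm_holds A.model A.carrier) V p c

/-- Membership in the Chern character set is being THE class `ch_p(V)`. [cite: Kobayashi1987, Ch. II §2 Thm. 2.16] -/
theorem mem_chernCharacterSet_iff_eq_chernCharacter (A : HodgeModel n X) {ι : Type} {r : ℕ}
    (V : SmoothComplexVectorBundle ι A.model A.carrier r) (p : ℕ) (c : complexBetti X (2 * p)) :
    c ∈ A.chernCharacterSet V p ↔ c = A.chernCharacter V p := by
  rw [A.chernCharacterSet_eq_singleton V p, Set.mem_singleton_iff]

end HodgeModel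

/-- **Thm. 11.32 ⊗ ℂ restated with the classes `ch_p(V)`**: the named fact
`span_holomorphicBundleChernCharacter_eq_algebraicClasses` says precisely that, for `X` smooth
projective with a Hodge model `A`, the `ℂ`-span of the classes `ch_p(V)` of the holomorphic cocycles
`V` is the space of algebraic classes `Nᵖ H²ᵖ(X(ℂ); ℂ)` — an unfolding, recorded to fix the reading
of the fact now that `ch_p(V)` is a single class. [cite: VoisinHodgeI2002, Thm. 11.32] -/
theorem span_holomorphicBundleChernCharacter_eq_algebraicClasses_iff :
    span_holomorphicBundleChernCharacter_eq_algebraicClasses ↔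
      ∀ ⦃n : ℕ⦄ ⦃X : Motives.SchemeOver ℂ⦄, Motives.IsSmoothProjective n X →
        ∀ (A : HodgeModel n X) (p : ℕ),
          Submodule.span ℂ {c | ∃ (ι : Type) (r : ℕ) (V : SmoothComplexVectorBundle ι A.model A.carrier r),
            V.IsHolomorphic ∧ c = A.chernCharacter V p} = algebraicClasses X p := by
  simp only [span_holomorphicBundleChernCharacter_eq_algebraicClasses,
    HodgeModel.holomorphicBundleChernCharacter_eq]

end Literature.AlgebraicGeometry.HodgeTheory

end
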